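import Literature.NumberTheory.LFunctions.Zhang2022.ObjectiveTwinKernelSlope

/-!
# Zhang (2022) design-space objective, twin part 6: `F_ℓ` on `ker 𝔅` is an explicit Hermitian pencil, for every `ℓ`

Y. Zhang, *Discrete mean estimates and the Landau–Siegel zero*, arXiv:2211.02515v1 (2022)
[Zhang2022LandauSiegel] — an unrefereed manuscript under adjudication. **This file SEARCHES and TYPES; it
makes no claim about Landau–Siegel zeros, about Theorems 1–2 of the manuscript, or about a repaired (2.32),
until a kernel theorem says so.** Companion of `ObjectiveTwinKernelSlope` (LANDAU–SIEGEL programme, cell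
`landau-siegel`, §A Lean twin; CONTROL item C2 of OBJECTIVE.md §5 and the B-ell block «K₀» of DESIGN-MAP-ell).

`ObjectiveTwinKernelSlope` proved that the `ℓ`-SLOPE at `ℓ = 1` of the deformed main-term form
`F_ℓ = mainTermFormEll ℓ` (`MainTermFormEll`) on `ker 𝔅 = span{k₁,k₂,k₃}`, `k_j(y) = e^{−iπjy}`, is the diagonal form
`D_K`. This file gives the WHOLE function of `ℓ`: for every `ℓ : ℝ` and all complex coefficients,

  `F_ℓ(x₁k₁ + x₂k₂ + x₃k₃) = ellFormQ ℓ x₁ x₂ x₃`                         (`mainTermFormEll_afeComb`)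
  `  = 8π(1−ℓ)(1−2ℓ)(1−3ℓ)|x₁|² + 8π(2−ℓ)(1−ℓ)(2−3ℓ)|x₂|² + 8π(3−ℓ)(3−2ℓ)(1−ℓ)|x₃|²`
  `    − 64(1−ℓ)²(1−3ℓ)·Im(x₁x̄₂) − 64(1−ℓ)²(3−ℓ)·Im(x₂x̄₃)`,

i.e. `F_ℓ|_K` is the Hermitian pencil `H(ℓ) = H₀ + ℓH₁ + ℓ²H₂ + ℓ³H₃` with diagonal `(8π/j)(j−ℓ)(j−2ℓ)(j−3ℓ)`
(= `mainTermFormEll_afeDir`), PURELY IMAGINARY `(1,2)` and `(2,3)` entries `∓32i(1−ℓ)²(1−3ℓ)`, `∓32i(1−ℓ)²(3−ℓ)`,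
and `(1,3)` entry `0` — the object of the record repair/num-1 L11 §3 (kit j251235: «F_ℓ restricted to ker 𝔅»;
evaluator-B `F_ell_coef0…3`), now a kernel identity for every `ℓ`. Consequences PROVED here:

* `ellFormQ_one`: `H(1) = 0` (`K ⊆ ker 𝔅`); `ellFormQ_eq_mul`: `H(ℓ) = (1−ℓ)·N(ℓ)` with `N(1) = −D_K`
  (`ellFormN_one`), and `hasDerivAt_ellFormQ`: `d/dℓ H(ℓ)|₁ = ellSlopeQ = D_K` — consistent with the slope theorem
  `hasDerivAt_mainTermFormEll_afeComb` of `ObjectiveTwinKernelSlope`; `mainTermFormEll_afeComb_neg_iff`: for `ℓ > 1`,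
  `F_ℓ(u) < 0 ↔ N(ℓ)(x) > 0`;
* `ellFormQ_ofReal`: on REAL coefficients the cross part vanishes — the AFE directions `k₁, k₂, k₃` are
  `F_ℓ`-orthogonal over `ℝ` for every `ℓ`, so `F_ℓ(Σ r_jk_j) = Σ (8π/j)(j−ℓ)(j−2ℓ)(j−3ℓ) r_j²` (the two-frequency
  profiles `k₁+k₂, k₂+k₃, k₁−k₃` of the B-ell «K₀-POS» designs are instances; their three cubics are typed in the
  companion pairs file of the B-ell typer, not restated here);
* `mainTermFormEll_afeComb13_neg`: for `1 < ℓ < 3/2` the complex plane `span_ℂ{k₁,k₃}` is NEGATIVE DEFINITE for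
  `F_ℓ` (the `(1,3)` entry vanishes and both diagonal cubics are `< 0` there), whereas `F_ℓ(k₂) > 0` for
  `1 < ℓ < 2` (`mainTermFormEll_afeDir_two_pos`): on the physical side `ℓ > 1` the form is INDEFINITE on `K`,
  negative exactly away from the middle frequency to leading order.

Method: `F_ℓ(u) = c₀ + c₁ℓ + c₂ℓ² + c₃ℓ³` with the four coefficients computed from the mode expansions of
`ObjectiveTwinKernelSlope` (`integral_afeComb'_mul_conj`, `integral_normSq_afeComb`, `integral_afeComb`,
`integral_afeComb_mul_conj_primitive`) — the same identities that gave the slope, now kept for all powers of `ℓ`.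
STATUS OF THE OBJECT (as in `MainTermFormEll`): for `ℓ ≠ 1`, `F_ℓ` is the CONTINUED main-term calculus (zero-spacing
scale deformed at fixed lengths), not the main term of a mean value the manuscript computes; that a design's normalised
means equal these values is registry row E-021/E-022 (open, asserted by no one here). Theorems only; no new `Prop` facts.
-/

noncomputable section

open Real Complex ComplexConjugate MeasureTheory Set intervalIntegral

namespace Literature.NumberTheory.LFunctions.Zhang2022

namespace Objective

/-! ## The pencil `H(ℓ)` as a real-valued Hermitian form in the coefficients -/

/-- **`F_ℓ` restricted to `ker 𝔅`, in coordinates**: `ellFormQ ℓ x₁ x₂ x₃ =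
8π(1−ℓ)(1−2ℓ)(1−3ℓ)|x₁|² + 8π(2−ℓ)(1−ℓ)(2−3ℓ)|x₂|² + 8π(3−ℓ)(3−2ℓ)(1−ℓ)|x₃|² − 64(1−ℓ)²(1−3ℓ)Im(x₁x̄₂)
− 64(1−ℓ)²(3−ℓ)Im(x₂x̄₃)` — diagonal `(8π/j)(j−ℓ)(j−2ℓ)(j−3ℓ)`, purely imaginary nearest-neighbour cross entries with
a double root at `ℓ = 1`, no `(1,3)` coupling (record repair/num-1 L11 §3, kit j251235).
[cite: Zhang2022LandauSiegel, §2 (2.10) p.4 (zero spacing α = π/log P), (2.13)] -/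
def ellFormQ (ℓ : ℝ) (x₁ x₂ x₃ : ℂ) : ℝ :=
  8 * π * ((1 - ℓ) * (1 - 2 * ℓ) * (1 - 3 * ℓ)) * ‖x₁‖ ^ 2
    + 8 * π * ((2 - ℓ) * (1 - ℓ) * (2 - 3 * ℓ)) * ‖x₂‖ ^ 2
    + 8 * π * ((3 - ℓ) * (3 - 2 * ℓ) * (1 - ℓ)) * ‖x₃‖ ^ 2
    - 64 * ((1 - ℓ) ^ 2 * (1 - 3 * ℓ)) * (x₁ * conj x₂).im
    - 64 * ((1 - ℓ) ^ 2 * (3 - ℓ)) * (x₂ * conj x₃).im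

/-- The quotient pencil `N(ℓ) = H(ℓ)/(1−ℓ)`: `8π(1−2ℓ)(1−3ℓ)|x₁|² + 8π(2−ℓ)(2−3ℓ)|x₂|² + 8π(3−ℓ)(3−2ℓ)|x₃|²
− 64(1−ℓ)(1−3ℓ)Im(x₁x̄₂) − 64(1−ℓ)(3−ℓ)Im(x₂x̄₃)`; for `ℓ > 1`, `F_ℓ(u) < 0 ↔ N(ℓ)(x) > 0`.
[cite: Zhang2022LandauSiegel, §2 (2.10) p.4 (zero spacing α = π/log P), (2.13)] -/
def ellFormN (ℓ : ℝ) (x₁ x₂ x₃ : ℂ) : ℝ :=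
  8 * π * ((1 - 2 * ℓ) * (1 - 3 * ℓ)) * ‖x₁‖ ^ 2
    + 8 * π * ((2 - ℓ) * (2 - 3 * ℓ)) * ‖x₂‖ ^ 2
    + 8 * π * ((3 - ℓ) * (3 - 2 * ℓ)) * ‖x₃‖ ^ 2
    - 64 * ((1 - ℓ) * (1 - 3 * ℓ)) * (x₁ * conj x₂).im
    - 64 * ((1 - ℓ) * (3 - ℓ)) * (x₂ * conj x₃).im

/-- `H(ℓ) = (1 − ℓ)·N(ℓ)`: every entry of the pencil vanishes at the physical point. [cite: Zhang2022LandauSiegel, §2 (2.10), (2.13)] -/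
theorem ellFormQ_eq_mul (ℓ : ℝ) (x₁ x₂ x₃ : ℂ) :
    ellFormQ ℓ x₁ x₂ x₃ = (1 - ℓ) * ellFormN ℓ x₁ x₂ x₃ := by
  unfold ellFormQ ellFormN; ring

/-- `H(1) = 0`: `K = span{k₁,k₂,k₃}` lies in `ker 𝔅` (`F₁ = 𝔅`, `mainTermFormEll_one`). [cite: Zhang2022LandauSiegel, §2 (2.10), (2.13)] -/
theorem ellFormQ_one (x₁ x₂ x₃ : ℂ) : ellFormQ 1 x₁ x₂ x₃ = 0 := by
  unfold ellFormQ; ring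

/-- `N(1) = −D_K = 16π|x₁|² − 8π|x₂|² + 16π|x₃|²` (so `H(ℓ) ≈ (1−ℓ)N(1) = (ℓ−1)D_K` to first order).
[cite: Zhang2022LandauSiegel, §2 (2.10), (2.13)] -/
theorem ellFormN_one (x₁ x₂ x₃ : ℂ) : ellFormN 1 x₁ x₂ x₃ = -ellSlopeQ x₁ x₂ x₃ := by
  rw [ellFormN, ellSlopeQ_eq]; ring

/-- A cubic in `ℓ` has derivative `c₁ + 2c₂ + 3c₃` at `ℓ = 1`. [folklore] -/
private theorem hasDerivAt_cubic' (c₀ c₁ c₂ c₃ : ℝ) :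
    HasDerivAt (fun ℓ : ℝ => c₀ + ℓ * c₁ + ℓ ^ 2 * c₂ + ℓ ^ 3 * c₃) (c₁ + 2 * c₂ + 3 * c₃) 1 := by
  have h1 : HasDerivAt (fun ℓ : ℝ => ℓ * c₁) (1 * c₁) 1 := (hasDerivAt_id (1:ℝ)).mul_const c₁
  have h2 : HasDerivAt (fun ℓ : ℝ => ℓ ^ 2 * c₂) (((2:ℕ) : ℝ) * 1 ^ (2 - 1) * c₂) 1 :=
    (hasDerivAt_pow 2 (1:ℝ)).mul_const c₂
  have h3 : HasDerivAt (fun ℓ : ℝ => ℓ ^ 3 * c₃) (((3:ℕ) : ℝ) * 1 ^ (3 - 1) * c₃) 1 :=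
    (hasDerivAt_pow 3 (1:ℝ)).mul_const c₃
  have h := (((hasDerivAt_const (1:ℝ) c₀).add h1).add h2).add h3
  refine h.congr_deriv ?_
  norm_num

/-- The `ℓ`-derivative of the closed form at `ℓ = 1` is the slope form `D_K = ellSlopeQ` of `ObjectiveTwinEllSlope`.
[cite: Zhang2022LandauSiegel, §2 (2.10), (2.13)] -/
theorem hasDerivAt_ellFormQ (x₁ x₂ x₃ : ℂ) :
    HasDerivAt (fun ℓ : ℝ => ellFormQ ℓ x₁ x₂ x₃) (ellSlopeQ x₁ x₂ x₃) 1 := by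
  -- `H(ℓ) = H₀ + ℓH₁ + ℓ²H₂ + ℓ³H₃` with the four coefficient forms written out
  have e : (fun ℓ : ℝ => ellFormQ ℓ x₁ x₂ x₃) = fun ℓ =>
      (8 * π * ‖x₁‖ ^ 2 + 32 * π * ‖x₂‖ ^ 2 + 72 * π * ‖x₃‖ ^ 2
          - 64 * (x₁ * conj x₂).im - 192 * (x₂ * conj x₃).im)
      + ℓ * (-(48 * π * ‖x₁‖ ^ 2) - 96 * π * ‖x₂‖ ^ 2 - 144 * π * ‖x₃‖ ^ 2
          + 320 * (x₁ * conj x₂).im + 448 * (x₂ * conj x₃).im)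
      + ℓ ^ 2 * (88 * π * (‖x₁‖ ^ 2 + ‖x₂‖ ^ 2 + ‖x₃‖ ^ 2)
          - 448 * (x₁ * conj x₂).im - 320 * (x₂ * conj x₃).im)
      + ℓ ^ 3 * (-(48 * π * ‖x₁‖ ^ 2) - 24 * π * ‖x₂‖ ^ 2 - 16 * π * ‖x₃‖ ^ 2
          + 192 * (x₁ * conj x₂).im + 64 * (x₂ * conj x₃).im) := by
    funext ℓ; unfold ellFormQ; ring
  rw [e]
  refine (hasDerivAt_cubic' _ _ _ _).congr_deriv ?_
  rw [ellSlopeQ_eq]; ring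

/-- **`F_ℓ`-orthogonality of the AFE directions over `ℝ`**: on real coefficients the cross part of `H(ℓ)` vanishes,
`F_ℓ(r₁k₁ + r₂k₂ + r₃k₃) = 8π(1−ℓ)(1−2ℓ)(1−3ℓ)r₁² + 8π(2−ℓ)(1−ℓ)(2−3ℓ)r₂² + 8π(3−ℓ)(3−2ℓ)(1−ℓ)r₃²` for every `ℓ`
(the cross integrals of two pure frequencies are purely imaginary). [cite: Zhang2022LandauSiegel, §2 (2.10), (2.13)] -/
theorem ellFormQ_ofReal (ℓ r₁ r₂ r₃ : ℝ) :
    ellFormQ ℓ r₁ r₂ r₃ = 8 * π * ((1 - ℓ) * (1 - 2 * ℓ) * (1 - 3 * ℓ)) * r₁ ^ 2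
      + 8 * π * ((2 - ℓ) * (1 - ℓ) * (2 - 3 * ℓ)) * r₂ ^ 2
      + 8 * π * ((3 - ℓ) * (3 - 2 * ℓ) * (1 - ℓ)) * r₃ ^ 2 := by
  unfold ellFormQ
  simp only [Complex.conj_ofReal, Complex.mul_im, Complex.ofReal_re, Complex.ofReal_im, mul_zero, zero_mul,
    add_zero, Complex.norm_real, Real.norm_eq_abs, sq_abs]
  ring

/-! ## Auxiliary normal forms of the constants (as in `ObjectiveTwinKernelSlope`) -/

/-- `‖z‖² = Re² + Im²`. [folklore] -/
private theorem normSq_re_im' (z : ℂ) : ‖z‖ ^ 2 = z.re ^ 2 + z.im ^ 2 := by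
  rw [Complex.sq_norm, Complex.normSq_apply]; ring

/-- `2/(πi) = −(2/π)i`. [folklore] -/
private theorem two_div_pi_I : (2 : ℂ) / ((π : ℂ) * Complex.I) = ((-(2 / π) : ℝ) : ℂ) * Complex.I := by
  have hne : (π : ℂ) * Complex.I ≠ 0 := mul_ne_zero (Complex.ofReal_ne_zero.mpr Real.pi_ne_zero) Complex.I_ne_zero
  rw [div_eq_iff hne]
  push_cast
  have hπ : (π : ℂ) ≠ 0 := Complex.ofReal_ne_zero.mpr Real.pi_ne_zero
  field_simp
  ring_nf
  rw [Complex.I_sq]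
  ring

/-- `2/(3πi) = −(2/(3π))i`. [folklore] -/
private theorem two_div_three_pi_I :
    (2 : ℂ) / (3 * (π : ℂ) * Complex.I) = ((-(2 / (3 * π)) : ℝ) : ℂ) * Complex.I := by
  have hne : 3 * (π : ℂ) * Complex.I ≠ 0 :=
    mul_ne_zero (mul_ne_zero three_ne_zero (Complex.ofReal_ne_zero.mpr Real.pi_ne_zero)) Complex.I_ne_zero
  rw [div_eq_iff hne]
  push_cast
  have hπ : (π : ℂ) ≠ 0 := Complex.ofReal_ne_zero.mpr Real.pi_ne_zero
  field_simp
  ring_nf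
  rw [Complex.I_sq]
  ring

/-- `x / c_j = x·(1/(jπ))·i` (`c_j = −iπj`). [folklore] -/
private theorem div_afeFreq (x : ℂ) {j : ℕ} (hj : j ≠ 0) :
    x / afeFreq j = x * (((1 / (j * π)) : ℝ) : ℂ) * Complex.I := by
  have hc := afeFreq_ne_zero hj
  rw [div_eq_iff hc]
  unfold afeFreq
  push_cast
  have hπ : (π : ℂ) ≠ 0 := Complex.ofReal_ne_zero.mpr Real.pi_ne_zero
  have hjc : (j : ℂ) ≠ 0 := Nat.cast_ne_zero.mpr hj
  field_simp
  ring_nf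
  rw [Complex.I_sq]
  ring

/-- `c_j = −(jπ)·i`. [folklore] -/
private theorem afeFreq_eq (j : ℕ) : afeFreq j = ((-(j * π) : ℝ) : ℂ) * Complex.I := by
  unfold afeFreq; push_cast; ring

/-! ## The identity `F_ℓ|_K = H(ℓ)` -/

/-- `‖u′‖²_{L²}` for `u = Σ x_jk_j`: `u′ = Σ (x_jc_j)k_j`, so it is the Gram form at the coefficients `x_jc_j`.
[cite: Zhang2022LandauSiegel, §2 (2.10), (2.13)] -/
theorem integral_normSq_afeComb' (x₁ x₂ x₃ : ℂ) :
    ∫ y in (0:ℝ)..1, ‖x₁ * afeDir' 1 y + x₂ * afeDir' 2 y + x₃ * afeDir' 3 y‖ ^ 2 =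
      kernelGramQ (x₁ * afeFreq 1) (x₂ * afeFreq 2) (x₃ * afeFreq 3) := by
  have e : ∀ y : ℝ, x₁ * afeDir' 1 y + x₂ * afeDir' 2 y + x₃ * afeDir' 3 y =
      (x₁ * afeFreq 1) * afeDir 1 y + (x₂ * afeFreq 2) * afeDir 2 y + (x₃ * afeFreq 3) * afeDir 3 y := by
    intro y; simp only [afeDir']; ring
  simp_rw [e]
  exact integral_normSq_afeComb _ _ _

/-- **`F_ℓ` on `ker 𝔅` is the pencil `H(ℓ)`**: for every `ℓ` and all complex `x₁, x₂, x₃`,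
`mainTermFormEll ℓ (x₁k₁ + x₂k₂ + x₃k₃) = ellFormQ ℓ x₁ x₂ x₃` (record repair/num-1 L11 §3, kit j251235: diagonal
`(8π/j)(j−ℓ)(j−2ℓ)(j−3ℓ)`, imaginary cross terms `32i(1−ℓ)²(1−3ℓ)`, `0`, `32i(1−ℓ)²(3−ℓ)` up to orientation).
[cite: Zhang2022LandauSiegel, §2 (2.10) p.4 (zero spacing α = π/log P), (2.13)] -/
theorem mainTermFormEll_afeComb (ℓ : ℝ) (x₁ x₂ x₃ : ℂ) :
    mainTermFormEll ℓ (fun y => x₁ * afeDir 1 y + x₂ * afeDir 2 y + x₃ * afeDir 3 y)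
      (fun y => x₁ * afeDir' 1 y + x₂ * afeDir' 2 y + x₃ * afeDir' 3 y) = ellFormQ ℓ x₁ x₂ x₃ := by
  set u : ℝ → ℂ := fun y => x₁ * afeDir 1 y + x₂ * afeDir 2 y + x₃ * afeDir 3 y with hu
  set u' : ℝ → ℂ := fun y => x₁ * afeDir' 1 y + x₂ * afeDir' 2 y + x₃ * afeDir' 3 y with hu'
  have hT0 := integral_normSq_afeComb' x₁ x₂ x₃
  have hT1 := integral_afeComb'_mul_conj x₁ x₂ x₃
  have hG := integral_normSq_afeComb x₁ x₂ x₃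
  have hI := integral_afeComb x₁ x₂ x₃
  have hT4 := integral_afeComb_mul_conj_primitive x₁ x₂ x₃
  have hu0 : u 0 = x₁ + x₂ + x₃ := by simp [hu, afeDir_zero]
  have hu1 : u 1 = -x₁ + x₂ - x₃ := by
    simp only [hu, afeDir_one]; ring
  rw [mainTermFormEll, hu0, hu1]
  simp only [hu, hu']
  rw [hT0, hT1, hG, hI, hT4, ellFormQ, kernelGramQ, kernelGramQ]
  -- normalise the constants to the shape `(real)·i`
  rw [div_afeFreq x₁ one_ne_zero, div_afeFreq x₂ two_ne_zero, div_afeFreq x₃ (by norm_num : (3:ℕ) ≠ 0),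
    two_div_pi_I, two_div_three_pi_I, afeFreq_eq 1, afeFreq_eq 2, afeFreq_eq 3]
  have hπ : π ≠ 0 := Real.pi_ne_zero
  simp only [map_add, map_mul, Complex.conj_ofReal, Complex.conj_I, normSq_re_im', Complex.add_re, Complex.add_im,
    Complex.sub_re, Complex.sub_im, Complex.mul_re, Complex.mul_im, Complex.neg_re, Complex.neg_im, Complex.I_re,
    Complex.I_im, Complex.ofReal_re, Complex.ofReal_im, Complex.conj_re, Complex.conj_im]
  push_cast
  field_simp
  ring

/-- `F_ℓ(u) = (1−ℓ)·N(ℓ)(x)` on `K`: for `ℓ > 1` a kernel combination has `F_ℓ < 0` exactly when `N(ℓ)(x) > 0`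
(the slope theorem `hasDerivAt_mainTermFormEll_afeComb` of `ObjectiveTwinKernelSlope` is the case `ℓ → 1`, `N(1) = −D_K`).
[cite: Zhang2022LandauSiegel, §2 (2.10), (2.13)] -/
theorem mainTermFormEll_afeComb_neg_iff {ℓ : ℝ} (hℓ : 1 < ℓ) (x₁ x₂ x₃ : ℂ) :
    mainTermFormEll ℓ (fun y => x₁ * afeDir 1 y + x₂ * afeDir 2 y + x₃ * afeDir 3 y)
      (fun y => x₁ * afeDir' 1 y + x₂ * afeDir' 2 y + x₃ * afeDir' 3 y) < 0 ↔ 0 < ellFormN ℓ x₁ x₂ x₃ := by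
  rw [mainTermFormEll_afeComb, ellFormQ_eq_mul]
  have h : 1 - ℓ < 0 := by linarith
  constructor
  · intro hlt
    by_contra hle
    have : 0 ≤ (1 - ℓ) * ellFormN ℓ x₁ x₂ x₃ := mul_nonneg_of_nonpos_of_nonpos h.le (not_lt.mp hle)
    linarith
  · intro hpos
    exact mul_neg_of_neg_of_pos h hpos

/-! ## Sign structure on the physical side `ℓ > 1` -/

/-- The middle frequency is POSITIVE for `1 < ℓ < 2`: `F_ℓ(k₂) = −8π(ℓ−1)(ℓ−2)(3ℓ−2) > 0` — so `F_ℓ` is indefinite,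
not negative, on `K` for `ℓ > 1` (compare `mainTermFormEll_neg_of_one_lt` on `k₁`). [cite: Zhang2022LandauSiegel, §2 (2.10), (2.13)] -/
theorem mainTermFormEll_afeDir_two_pos {ℓ : ℝ} (h₁ : 1 < ℓ) (h₂ : ℓ < 2) :
    0 < mainTermFormEll ℓ (afeDir 2) (afeDir' 2) := by
  rw [mainTermFormEll_afeDir_two]
  have a : 0 < ℓ - 1 := by linarith
  have b : ℓ - 2 < 0 := by linarith
  have c : 0 < 3 * ℓ - 2 := by linarith
  have : (ℓ - 1) * (ℓ - 2) * (3 * ℓ - 2) < 0 := by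
    have := mul_neg_of_pos_of_neg a b
    exact mul_neg_of_neg_of_pos this c
  nlinarith [Real.pi_pos]

/-- **The outer plane `span_ℂ{k₁,k₃}` is negative definite for `1 < ℓ < 3/2`**: there `H(ℓ)` has no `(1,3)` coupling and
both diagonal cubics `8π(1−ℓ)(1−2ℓ)(1−3ℓ)`, `8π(3−ℓ)(3−2ℓ)(1−ℓ)` are negative, so `F_ℓ(x₁k₁ + x₃k₃) < 0` for every
`(x₁,x₃) ≠ 0` — e.g. the B-ell design «K₀-POS-001» `k₁ − k₃` at any `ℓ = 1 + ε`, `0 < ε < 1/2`.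
[cite: Zhang2022LandauSiegel, §2 (2.10), (2.13)] -/
theorem mainTermFormEll_afeComb13_neg {ℓ : ℝ} (h₁ : 1 < ℓ) (h₂ : ℓ < 3 / 2) {x₁ x₃ : ℂ} (hx : x₁ ≠ 0 ∨ x₃ ≠ 0) :
    mainTermFormEll ℓ (fun y => x₁ * afeDir 1 y + 0 * afeDir 2 y + x₃ * afeDir 3 y)
      (fun y => x₁ * afeDir' 1 y + 0 * afeDir' 2 y + x₃ * afeDir' 3 y) < 0 := by
  rw [mainTermFormEll_afeComb, ellFormQ]
  simp only [norm_zero, map_zero, mul_zero, zero_mul, Complex.zero_im, sub_zero, add_zero,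
    zero_pow (two_ne_zero)]
  have d1 : 8 * π * ((1 - ℓ) * (1 - 2 * ℓ) * (1 - 3 * ℓ)) < 0 := by
    have a : 1 - ℓ < 0 := by linarith
    have b : 1 - 2 * ℓ < 0 := by linarith
    have c : 1 - 3 * ℓ < 0 := by linarith
    have : (1 - ℓ) * (1 - 2 * ℓ) * (1 - 3 * ℓ) < 0 := mul_neg_of_pos_of_neg (mul_pos_of_neg_of_neg a b) c
    nlinarith [Real.pi_pos]
  have d3 : 8 * π * ((3 - ℓ) * (3 - 2 * ℓ) * (1 - ℓ)) < 0 := by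
    have a : 0 < 3 - ℓ := by linarith
    have b : 0 < 3 - 2 * ℓ := by linarith
    have c : 1 - ℓ < 0 := by linarith
    have : (3 - ℓ) * (3 - 2 * ℓ) * (1 - ℓ) < 0 := mul_neg_of_pos_of_neg (mul_pos a b) c
    nlinarith [Real.pi_pos]
  rcases hx with h | h
  · have hp : 0 < ‖x₁‖ ^ 2 := by positivity
    have hq : 0 ≤ ‖x₃‖ ^ 2 := by positivity
    nlinarith
  · have hp : 0 < ‖x₃‖ ^ 2 := by positivity
    have hq : 0 ≤ ‖x₁‖ ^ 2 := by positivity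
    nlinarith

/-! ## The sign box is not positivity: indefiniteness on `[1/2, 2/3]` (wall-value-free span)

On the leaf `1/2 ≤ ℓ ≤ 2/3` every DIAGONAL value `F_ℓ(k_j)` is `≥ 0` (the Lemma-2.3-style sign box of the
single exponentials), yet the pencil is INDEFINITE there on `span{k₁,k₂}`: the purely imaginary cross entry wins
(`det = D₁D₂ − 1024(1−ℓ)⁴(1−3ℓ)² < 0`). Two rational witnesses (cell ls-ref-1 falsifier run 2026-08-26T20:26:27Z,
float min eigenvalues −1.47 / −2.42; exact: `3π/2 − √(9π²/4 + 16)`, `(4/9)(π − √(π² + 64))`). The negative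
directions have non-zero wall value `u(1) ≠ 0`, consistent with `ObjectiveTwinEllFrame` (PSD below `ℓ = 1` on
wall-vanishing profiles). -/

/-- At `ℓ = 2/3`: `F_{2/3}(k₁ + i·k₂) = (8π − 64)/9 < 0`. [cite: Zhang2022LandauSiegel, §2 (2.10), (2.13)] -/
theorem mainTermFormEll_twoThirds_witness :
    mainTermFormEll (2 / 3) (fun y => 1 * afeDir 1 y + Complex.I * afeDir 2 y + 0 * afeDir 3 y)
        (fun y => 1 * afeDir' 1 y + Complex.I * afeDir' 2 y + 0 * afeDir' 3 y) = (8 * π - 64) / 9 ∧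
      mainTermFormEll (2 / 3) (fun y => 1 * afeDir 1 y + Complex.I * afeDir 2 y + 0 * afeDir 3 y)
        (fun y => 1 * afeDir' 1 y + Complex.I * afeDir' 2 y + 0 * afeDir' 3 y) < 0 := by
  have hv : mainTermFormEll (2 / 3) (fun y => 1 * afeDir 1 y + Complex.I * afeDir 2 y + 0 * afeDir 3 y)
      (fun y => 1 * afeDir' 1 y + Complex.I * afeDir' 2 y + 0 * afeDir' 3 y) = (8 * π - 64) / 9 := by
    rw [mainTermFormEll_afeComb, ellFormQ]
    simp
    ring
  refine ⟨hv, ?_⟩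
  rw [hv]
  have := Real.pi_lt_d2
  have : 8 * π - 64 < 0 := by linarith
  exact div_neg_of_neg_of_pos this (by norm_num)

/-- At `ℓ = 1/2`: `F_{1/2}(k₁ + (4/(3π))i·k₂) = −16/(3π) < 0` (the optimum over `t` of `k₁ + t·i·k₂`).
[cite: Zhang2022LandauSiegel, §2 (2.10), (2.13)] -/
theorem mainTermFormEll_half_witness :
    mainTermFormEll (1 / 2)
        (fun y => 1 * afeDir 1 y + (((4 / (3 * π) : ℝ) : ℂ) * Complex.I) * afeDir 2 y + 0 * afeDir 3 y)
        (fun y => 1 * afeDir' 1 y + (((4 / (3 * π) : ℝ) : ℂ) * Complex.I) * afeDir' 2 y + 0 * afeDir' 3 y)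
          = -(16 / (3 * π)) ∧
      mainTermFormEll (1 / 2)
        (fun y => 1 * afeDir 1 y + (((4 / (3 * π) : ℝ) : ℂ) * Complex.I) * afeDir 2 y + 0 * afeDir 3 y)
        (fun y => 1 * afeDir' 1 y + (((4 / (3 * π) : ℝ) : ℂ) * Complex.I) * afeDir' 2 y + 0 * afeDir' 3 y)
          < 0 := by
  have hπ : π ≠ 0 := Real.pi_ne_zero
  have hv : mainTermFormEll (1 / 2)
      (fun y => 1 * afeDir 1 y + (((4 / (3 * π) : ℝ) : ℂ) * Complex.I) * afeDir 2 y + 0 * afeDir 3 y)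
      (fun y => 1 * afeDir' 1 y + (((4 / (3 * π) : ℝ) : ℂ) * Complex.I) * afeDir' 2 y + 0 * afeDir' 3 y)
        = -(16 / (3 * π)) := by
    rw [mainTermFormEll_afeComb, ellFormQ]
    simp only [one_mul, norm_one, one_pow, norm_mul, Complex.norm_real, Complex.norm_I, mul_one, norm_zero,
      zero_pow (two_ne_zero), mul_zero, add_zero, map_mul, Complex.conj_ofReal, Complex.conj_I, Complex.mul_im,
      Complex.ofReal_re, Complex.ofReal_im, Complex.neg_re, Complex.neg_im,
      Complex.I_re, Complex.I_im, zero_mul, map_zero, Complex.zero_im, sub_zero, Real.norm_eq_abs]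
    rw [abs_of_pos (by positivity)]
    field_simp
    ring
  refine ⟨hv, ?_⟩
  rw [hv]
  have : 0 < 16 / (3 * π) := by positivity
  linarith

end Objective

end Literature.NumberTheory.LFunctions.Zhang2022
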